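import Summits.BirchSwinnertonDyer.BirchSwinnertonDyer.Theorems.SignedLowerHalvesSmallImageLowerHalfBothSignsRttD2SeqJ3RLocalTerms
import Literature.NumberTheory.GaloisRepresentations.CoinducedDiscreteGaloisModule
import Literature.NumberTheory.GaloisRepresentations.ContinuousShapiroLiftMackeyH1
import Literature.NumberTheory.GaloisRepresentations.ShapiroLocalDualityOpenSubgroup
import Literature.NumberTheory.GaloisRepresentations.LocalTatePairing
import Literature.NumberTheory.GaloisCohomology.ArchimedeanInvariantMap
import HarnessLib

/-!
# Route `SignedLowerHalves`, crux L `SmallImageLowerHalfBothSigns` (stmt-BirchSwinnertonDyer-23599), line `rtt_w3` v16 — E2, row J3 residual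
# (`hsolL`), brick H3: THE LOCAL DICTIONARY AT A NON-SPLIT PLACE between the layer group `H¹(U_{v₀}, A)` and the base-field local cohomology
# `H¹(K_{v₀}, Maps(Γ_K ⧸ U, X)^D)` of the Tate dual of the COINDUCED module (Shapiro ∘ Mackey⁻¹ ∘ Ψ), and the identification of the tree's
# base-field local Tate pairing `localTatePairingZMod` (canonical invariants) with J3's cor-model layer pairing `localPairingSubgroup`

WIDTH seat `bsd-line-slh-p3-w3` g23 under LEAD `cruxlead-stmt-BirchSwinnertonDyer-23599` g11 (cell `bsd-ssimc`); helper `--supports stmt-BirchSwinnertonDyer-23599`.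
DEFINITIONS WITH BODIES (three `AddEquiv`s and their composite) + THEOREMS; no named fact, no instance, no `sorry`. HONEST FRAMING: bookkeeping that lets the
tree's base-field Poitou–Tate SOLVABILITY (`LocalInvariants.SelmerComplement.exists_selmer_localTatePairing_eq_of_subgroup`, fed by
`PoitouTateFinite.PoitouTateReduction.selmerComplement_canonical_holds`) be applied to the coinduced module `Maps(Γ_K ⧸ U, X)` and read at the layer `K̄^U`
(the next bricks); nothing about any curve; E2, crux L, crux M, BSD remain OPEN and are proved for NO curve.

Setting: `K` a number field, `n ≥ 1`, finite discrete `Γ_K`-modules `X` (`ρX`) and `A` (`ρA`) with a `Γ_K`-equivariant bi-additive `B : X × A → μₙ`, `U ⊴ Γ_K` open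
normal of finite index, `ρ := ρX.coind U hU = Maps(Γ_K ⧸ U, X)`, `Ψ = coindTateDualMor ρX ρA U B hU hB : Maps(Γ_K ⧸ U, A) ⟶ ρ^D` (an isomorphism when `a ↦ B(·, a)` is
bijective), a finite place `v₀` with ONE place of `K̄^U` above it (`ē` onto), `θ = res_{v₀}`, `U_{v₀} = θ⁻¹U`.
* §1 `shapiroEquivLocal` (`H¹(U_{v₀}, A) ≃+ H¹(K_{v₀}, Maps(Γ_{K_{v₀}} ⧸ U_{v₀}, A))`), `mackeyEquivLocal` (one orbit: `H¹(K_{v₀}, Maps(Γ_K ⧸ U, A)|) ≃+ H¹(K_{v₀}, Maps(Γ_{K_{v₀}} ⧸ U_{v₀}, A))`,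
  `H¹(Φ₁)`), `dualEquivLocal` (`H¹(Ψ|)`), ★ `layerToDualLocal` = their composite `e : H¹(U_{v₀}, A) ≃+ H¹(K_{v₀}, ρ^D)`.
* §2 ★ `layerToDualLocal_map_comapSubtypeHom` — `e(θ_U^* c) = loc_{v₀}(H¹(Ψ)(Sh_U c))` for global `c ∈ H¹(U, A)`.
* §3 ★★ `localTatePairingZMod_canonical_layerToDualLocal` — `⟨loc_{v₀}(Sh_U y), e ℓ⟩_{v₀}^{can} = localPairingSubgroup … U_{v₀} (θ_U^* y) ℓ` (the CANONICAL base-field local Tate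
  pairing of the coinduced module against `e ℓ` IS J3's layer pairing; adjoint naturality across `Ψ`, one-orbit Mackey for cup products, bridge R1).
References: [NeukirchSchmidtWingberg2008] I §5 (1.5.3)(iv), (1.5.6)–(1.5.7), I §6 (1.6.4), (7.2.6); [MilneADT2006] I Cor. 2.3, I §6 (proof of Prop. 6.9); [Brown1982] III §5 (5.6)(b).
-/

set_option autoImplicit false
set_option linter.dupNamespace false -- D-0017: single-problem summit, the namespace repeats the problem name by design
noncomputable section

open scoped Classical
open CategoryTheory Function NumberField IsDedekindDomain Field

namespace Summit.BirchSwinnertonDyer.BirchSwinnertonDyer.Theorems.SmallImageRttD2Seq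

open Literature.NumberTheory.GaloisRepresentations Literature.NumberTheory.GaloisCohomology Literature.NumberTheory.EllipticCurves
open Literature.NumberTheory.GaloisRepresentations.DiscreteGaloisModule

-- compactness of absolute Galois groups: local instances (as in `LocalPairingSubgroup.lean`, `LocalTatePairing.lean`)
attribute [local instance] absoluteGaloisGroup_compactSpace compactSpace_of_isClosed_subgroup

section Dict

variable (K : Type) [Field K] [NumberField K] (n : ℕ) [NeZero n]
  {MX MA : Type} [AddCommGroup MX] [TopologicalSpace MX] [DiscreteTopology MX] [Finite MX]
  [AddCommGroup MA] [TopologicalSpace MA] [DiscreteTopology MA] [Finite MA]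
  (ρX : DiscreteGaloisModule K MX) (ρA : DiscreteGaloisModule K MA)
  (B : MX →+ MA →+ MuCarrier K n) (hB : ∀ (σ : absoluteGaloisGroup K) (x : MX) (a : MA), B (ρX σ x) (ρA σ a) = mu K n σ (B x a))
  (U : Subgroup (absoluteGaloisGroup K)) [hUn : U.Normal] (hU : IsOpen (U : Set (absoluteGaloisGroup K))) [Fintype (absoluteGaloisGroup K ⧸ U)]
  (v₀ : HeightOneSpectrum (𝓞 K))
  [hfq : Fintype (absoluteGaloisGroup (v₀.adicCompletion K) ⧸ localSubgroupOfEmb U (closureEmb (K := K) (v₀.adicCompletion K)))]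

/-! ## §1. The three equivalences and their composite -/

/-- **Local Shapiro at the layer**: `Sh_{U_{v₀}} : H¹(U_{v₀}, A) ≃+ H¹(K_{v₀}, Maps(Γ_{K_{v₀}} ⧸ U_{v₀}, A))` (the tree's degree-one Shapiro lift, bijective).
[cite: NeukirchSchmidtWingberg2008, I §6 Prop. (1.6.4)] -/
def shapiroEquivLocal {sD : absoluteGaloisGroup (v₀.adicCompletion K) ⧸ localSubgroupOfEmb U (closureEmb (K := K) (v₀.adicCompletion K)) → absoluteGaloisGroup (v₀.adicCompletion K)}
    (hsD : ∀ y, (sD y : absoluteGaloisGroup (v₀.adicCompletion K) ⧸ localSubgroupOfEmb U (closureEmb (K := K) (v₀.adicCompletion K))) = y)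
    (hsD1 : sD ((1 : absoluteGaloisGroup (v₀.adicCompletion K)) : _ ⧸ localSubgroupOfEmb U (closureEmb (K := K) (v₀.adicCompletion K))) = 1) :
    (continuousCohomology 1 (subgroupRep (TopRep.res (resGalOfEmb (closureEmb (K := K) (v₀.adicCompletion K)) : absoluteGaloisGroup (v₀.adicCompletion K) →* absoluteGaloisGroup K) ρA.toTopRep)
        (U.comap (resGalOfEmb (closureEmb (K := K) (v₀.adicCompletion K)) : absoluteGaloisGroup (v₀.adicCompletion K) →* absoluteGaloisGroup K))) : Type) ≃+
      (continuousCohomology 1 (coindFin.{0, 0} (TopRep.res (resGalOfEmb (closureEmb (K := K) (v₀.adicCompletion K)) : absoluteGaloisGroup (v₀.adicCompletion K) →* absoluteGaloisGroup K) ρA.toTopRep)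
        (U.comap (resGalOfEmb (closureEmb (K := K) (v₀.adicCompletion K)) : absoluteGaloisGroup (v₀.adicCompletion K) →* absoluteGaloisGroup K))) : Type) :=
  AddEquiv.ofBijective
    (shapiroLift (TopRep.res (resGalOfEmb (closureEmb (K := K) (v₀.adicCompletion K)) : absoluteGaloisGroup (v₀.adicCompletion K) →* absoluteGaloisGroup K) ρA.toTopRep)
      (U.comap (resGalOfEmb (closureEmb (K := K) (v₀.adicCompletion K)) : absoluteGaloisGroup (v₀.adicCompletion K) →* absoluteGaloisGroup K))
      (isOpen_comap U (resGalOfEmb (closureEmb (K := K) (v₀.adicCompletion K))) hU) hsD hsD1).toAddMonoidHom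
    ⟨shapiroLift_injective _ _ _ hsD hsD1, shapiroLift_surjective _ _ _ hsD hsD1⟩

omit [Finite MA] in
/-- **Mackey, one orbit**: `Φ₁ : Maps(Γ_K ⧸ U, A)|_{Γ_{K_{v₀}}} → Maps(Γ_{K_{v₀}} ⧸ U_{v₀}, A)` (`resCoindFinHom`) is a bijection when `ē` is onto (one orbit: the family `(Φ₁)`
indexed by `Unit` is Mackey's decomposition), hence so is `H¹(Φ₁)` (discrete coefficients). [cite: Brown1982, III §5 (5.6)(b)] [cite: NeukirchSchmidtWingberg2008, I §5 (1.5.6)–(1.5.7)] -/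
theorem bijective_cohomologyMap_resCoindFinHom (hsurj : Surjective (quotientMapOfHom U (resGalOfEmb (closureEmb (K := K) (v₀.adicCompletion K))))) :
    Bijective (cohomologyMap (resCoindFinHom ρA.toTopRep U (resGalOfEmb (closureEmb (K := K) (v₀.adicCompletion K)))) 1) := by
  letI hfq' : Fintype (absoluteGaloisGroup (v₀.adicCompletion K) ⧸ U.comap (resGalOfEmb (closureEmb (K := K) (v₀.adicCompletion K)) : absoluteGaloisGroup (v₀.adicCompletion K) →* absoluteGaloisGroup K)) := hfq
  haveI : DiscreteTopology (TopRep.res (resGalOfEmb (closureEmb (K := K) (v₀.adicCompletion K)) : absoluteGaloisGroup (v₀.adicCompletion K) →* absoluteGaloisGroup K) (coindFin.{0, 0} ρA.toTopRep U)) :=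
    inferInstanceAs (DiscreteTopology (absoluteGaloisGroup K ⧸ U → MA))
  haveI : DiscreteTopology (coindFin.{0, 0} (TopRep.res (resGalOfEmb (closureEmb (K := K) (v₀.adicCompletion K)) : absoluteGaloisGroup (v₀.adicCompletion K) →* absoluteGaloisGroup K) ρA.toTopRep)
      (U.comap (resGalOfEmb (closureEmb (K := K) (v₀.adicCompletion K)) : absoluteGaloisGroup (v₀.adicCompletion K) →* absoluteGaloisGroup K))) :=
    inferInstanceAs (DiscreteTopology (absoluteGaloisGroup (v₀.adicCompletion K) ⧸ U.comap (resGalOfEmb (closureEmb (K := K) (v₀.adicCompletion K)) : absoluteGaloisGroup (v₀.adicCompletion K) →* absoluteGaloisGroup K) → MA))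
  refine bijective_cohomologyMap_of_bijective_of_discrete _ ?_ 1
  -- one orbit: `(Unit, y') ↦ ē(y')·1` is a bijection, so Mackey's module-level decomposition is `Φ₁` alone
  have hbij : Bijective fun q : Unit × (absoluteGaloisGroup (v₀.adicCompletion K) ⧸
        U.comap (resGalOfEmb (closureEmb (K := K) (v₀.adicCompletion K)) : absoluteGaloisGroup (v₀.adicCompletion K) →* absoluteGaloisGroup K)) ↦
      quotientMapOfHom U (resGalOfEmb (closureEmb (K := K) (v₀.adicCompletion K))) q.2 *
        (((fun _ : Unit ↦ (1 : absoluteGaloisGroup K)) q.1 : absoluteGaloisGroup K) : absoluteGaloisGroup K ⧸ U) := by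
    have hinj := quotientMapOfHom_injective U (resGalOfEmb (closureEmb (K := K) (v₀.adicCompletion K)))
    constructor
    · rintro ⟨u₁, y₁⟩ ⟨u₂, y₂⟩ h
      simp only [QuotientGroup.mk_one, mul_one] at h
      exact Prod.ext (Subsingleton.elim _ _) (hinj h)
    · intro y
      obtain ⟨y', hy'⟩ := hsurj y
      exact ⟨((), y'), by simp only [QuotientGroup.mk_one, mul_one]; exact hy'⟩
  have hj := resCoindFinHomR_jointly_bijective ρA.toTopRep U (resGalOfEmb (closureEmb (K := K) (v₀.adicCompletion K))) (fun _ : Unit ↦ 1) hbij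
  have key : ∀ F : coindFin ρA.toTopRep U,
      (resCoindFinHomR ρA.toTopRep U (resGalOfEmb (closureEmb (K := K) (v₀.adicCompletion K)))
          ((1 : absoluteGaloisGroup K) : absoluteGaloisGroup K ⧸ U)).hom F =
        (resCoindFinHom ρA.toTopRep U (resGalOfEmb (closureEmb (K := K) (v₀.adicCompletion K)))).hom F := fun F ↦ by
    rw [QuotientGroup.mk_one]; exact resCoindFinHomR_one ρA.toTopRep U _ F
  constructor
  · intro F₁ F₂ h
    apply hj.1
    funext i
    exact (key F₁).trans (h.trans (key F₂).symm)
  · intro F'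
    obtain ⟨F, hF⟩ := hj.2 fun _ ↦ F'
    exact ⟨F, (key F).symm.trans (congrFun hF ())⟩

/-- **`H¹(Φ₁)` as an equivalence** `H¹(K_{v₀}, Maps(Γ_K ⧸ U, A)|) ≃+ H¹(K_{v₀}, Maps(Γ_{K_{v₀}} ⧸ U_{v₀}, A))` (one orbit). [cite: Brown1982, III §5 (5.6)(b)] -/
def mackeyEquivLocal (hsurj : Surjective (quotientMapOfHom U (resGalOfEmb (closureEmb (K := K) (v₀.adicCompletion K))))) :
    (continuousCohomology 1 (TopRep.res (resGalOfEmb (closureEmb (K := K) (v₀.adicCompletion K)) : absoluteGaloisGroup (v₀.adicCompletion K) →* absoluteGaloisGroup K) (coindFin.{0, 0} ρA.toTopRep U)) : Type) ≃+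
      (continuousCohomology 1 (coindFin.{0, 0} (TopRep.res (resGalOfEmb (closureEmb (K := K) (v₀.adicCompletion K)) : absoluteGaloisGroup (v₀.adicCompletion K) →* absoluteGaloisGroup K) ρA.toTopRep)
        (U.comap (resGalOfEmb (closureEmb (K := K) (v₀.adicCompletion K)) : absoluteGaloisGroup (v₀.adicCompletion K) →* absoluteGaloisGroup K))) : Type) :=
  AddEquiv.ofBijective (cohomologyMap (resCoindFinHom ρA.toTopRep U (resGalOfEmb (closureEmb (K := K) (v₀.adicCompletion K)))) 1).hom.toLinearMap.toAddMonoidHom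
    (bijective_cohomologyMap_resCoindFinHom K ρA U v₀ hsurj)

/-- **`H¹(Ψ|_{Γ_{K_{v₀}}})` as an equivalence** `H¹(K_{v₀}, Maps(Γ_K ⧸ U, A)|) ≃+ H¹(K_{v₀}, ρ^D|)` for `ρ = Maps(Γ_K ⧸ U, X)` (`Ψ` is bijective when `a ↦ B(·, a)` is:
`coindTateDualHom_bijective`; discrete coefficients). [cite: MilneADT2006, Ch. I §0, Cor. 2.3] -/
def dualEquivLocal (hBbij : Bijective fun a : MA ↦ B.flip a) :
    (continuousCohomology 1 (TopRep.res (resGalOfEmb (closureEmb (K := K) (v₀.adicCompletion K)) : absoluteGaloisGroup (v₀.adicCompletion K) →* absoluteGaloisGroup K) (coindFin.{0, 0} ρA.toTopRep U)) : Type) ≃+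
      galoisCohomology (((ρX.coind U hU).tateDual n).toLocal (Sum.inr v₀)) 1 :=
  haveI : DiscreteTopology (TopRep.res (resGalOfEmb (closureEmb (K := K) (v₀.adicCompletion K)) : absoluteGaloisGroup (v₀.adicCompletion K) →* absoluteGaloisGroup K) (coindFin.{0, 0} ρA.toTopRep U)) :=
    inferInstanceAs (DiscreteTopology (absoluteGaloisGroup K ⧸ U → MA))
  haveI : DiscreteTopology (TopRep.res (resGalOfEmb (closureEmb (K := K) (v₀.adicCompletion K)) : absoluteGaloisGroup (v₀.adicCompletion K) →* absoluteGaloisGroup K) ((ρX.coind U hU).tateDual n).toTopRep) :=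
    inferInstanceAs (DiscreteTopology (TateDual K (absoluteGaloisGroup K ⧸ U → MX) n))
  AddEquiv.ofBijective
    (cohomologyMap ((TopRep.resFunctor (resGalOfEmb (closureEmb (K := K) (v₀.adicCompletion K)) : absoluteGaloisGroup (v₀.adicCompletion K) →* absoluteGaloisGroup K)).map (coindTateDualMor ρX ρA U B hU hB)) 1).hom.toLinearMap.toAddMonoidHom
    (bijective_cohomologyMap_of_bijective_of_discrete _ (coindTateDualHom_bijective U B hBbij) 1)

/-- ★ **The dictionary `e : H¹(U_{v₀}, A) ≃+ H¹(K_{v₀}, Maps(Γ_K ⧸ U, X)^D)`** at a place with one place of `K̄^U` above it: local Shapiro, then Mackey's `Φ₁` backwards, then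
`Ψ`. [cite: NeukirchSchmidtWingberg2008, I §6 Prop. (1.6.4), I §5 (1.5.6)] [cite: MilneADT2006, Ch. I Cor. 2.3] -/
def layerToDualLocal (hBbij : Bijective fun a : MA ↦ B.flip a) {sD : absoluteGaloisGroup (v₀.adicCompletion K) ⧸ localSubgroupOfEmb U (closureEmb (K := K) (v₀.adicCompletion K)) → absoluteGaloisGroup (v₀.adicCompletion K)}
    (hsD : ∀ y, (sD y : absoluteGaloisGroup (v₀.adicCompletion K) ⧸ localSubgroupOfEmb U (closureEmb (K := K) (v₀.adicCompletion K))) = y)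
    (hsD1 : sD ((1 : absoluteGaloisGroup (v₀.adicCompletion K)) : _ ⧸ localSubgroupOfEmb U (closureEmb (K := K) (v₀.adicCompletion K))) = 1) (hsurj : Surjective (quotientMapOfHom U (resGalOfEmb (closureEmb (K := K) (v₀.adicCompletion K))))) :
    (continuousCohomology 1 (subgroupRep (TopRep.res (resGalOfEmb (closureEmb (K := K) (v₀.adicCompletion K)) : absoluteGaloisGroup (v₀.adicCompletion K) →* absoluteGaloisGroup K) ρA.toTopRep)
        (U.comap (resGalOfEmb (closureEmb (K := K) (v₀.adicCompletion K)) : absoluteGaloisGroup (v₀.adicCompletion K) →* absoluteGaloisGroup K))) : Type) ≃+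
      galoisCohomology (((ρX.coind U hU).tateDual n).toLocal (Sum.inr v₀)) 1 :=
  (shapiroEquivLocal K ρA U hU v₀ hsD hsD1).trans
    ((mackeyEquivLocal K ρA U v₀ hsurj).symm.trans (dualEquivLocal K n ρX ρA B hB U hU v₀ hBbij))

omit [Finite MA] hUn [Fintype (absoluteGaloisGroup K ⧸ U)] hfq in
/-- Unfolding `shapiroEquivLocal`. [folklore] -/
theorem shapiroEquivLocal_apply {sD : absoluteGaloisGroup (v₀.adicCompletion K) ⧸ localSubgroupOfEmb U (closureEmb (K := K) (v₀.adicCompletion K)) → absoluteGaloisGroup (v₀.adicCompletion K)}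
    (hsD : ∀ y, (sD y : absoluteGaloisGroup (v₀.adicCompletion K) ⧸ localSubgroupOfEmb U (closureEmb (K := K) (v₀.adicCompletion K))) = y)
    (hsD1 : sD ((1 : absoluteGaloisGroup (v₀.adicCompletion K)) : _ ⧸ localSubgroupOfEmb U (closureEmb (K := K) (v₀.adicCompletion K))) = 1)
    (x : continuousCohomology 1 (subgroupRep (TopRep.res (resGalOfEmb (closureEmb (K := K) (v₀.adicCompletion K)) : absoluteGaloisGroup (v₀.adicCompletion K) →* absoluteGaloisGroup K) ρA.toTopRep) (U.comap (resGalOfEmb (closureEmb (K := K) (v₀.adicCompletion K)) : absoluteGaloisGroup (v₀.adicCompletion K) →* absoluteGaloisGroup K)))) :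
    shapiroEquivLocal K ρA U hU v₀ hsD hsD1 x =
      shapiroLift (TopRep.res (resGalOfEmb (closureEmb (K := K) (v₀.adicCompletion K)) : absoluteGaloisGroup (v₀.adicCompletion K) →* absoluteGaloisGroup K) ρA.toTopRep) (U.comap (resGalOfEmb (closureEmb (K := K) (v₀.adicCompletion K)) : absoluteGaloisGroup (v₀.adicCompletion K) →* absoluteGaloisGroup K))
        (isOpen_comap U (resGalOfEmb (closureEmb (K := K) (v₀.adicCompletion K))) hU) hsD hsD1 x :=
  rfl

omit [Finite MA] in
/-- Unfolding `mackeyEquivLocal`. [folklore] -/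
theorem mackeyEquivLocal_apply (hsurj : Surjective (quotientMapOfHom U (resGalOfEmb (closureEmb (K := K) (v₀.adicCompletion K)))))
    (z : continuousCohomology 1 (TopRep.res (resGalOfEmb (closureEmb (K := K) (v₀.adicCompletion K)) : absoluteGaloisGroup (v₀.adicCompletion K) →* absoluteGaloisGroup K) (coindFin.{0, 0} ρA.toTopRep U))) :
    mackeyEquivLocal K ρA U v₀ hsurj z = cohomologyMap (resCoindFinHom ρA.toTopRep U (resGalOfEmb (closureEmb (K := K) (v₀.adicCompletion K)))) 1 z :=
  rfl

omit [NeZero n] [Finite MA] hUn hfq in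
/-- Unfolding `dualEquivLocal`. [folklore] -/
theorem dualEquivLocal_apply (hBbij : Bijective fun a : MA ↦ B.flip a)
    (z : continuousCohomology 1 (TopRep.res (resGalOfEmb (closureEmb (K := K) (v₀.adicCompletion K)) : absoluteGaloisGroup (v₀.adicCompletion K) →* absoluteGaloisGroup K) (coindFin.{0, 0} ρA.toTopRep U))) :
    dualEquivLocal K n ρX ρA B hB U hU v₀ hBbij z =
      cohomologyMap ((TopRep.resFunctor (resGalOfEmb (closureEmb (K := K) (v₀.adicCompletion K)) : absoluteGaloisGroup (v₀.adicCompletion K) →* absoluteGaloisGroup K)).map (coindTateDualMor ρX ρA U B hU hB)) 1 z :=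
  rfl

omit [NeZero n] [Finite MA] in
/-- Unfolding `layerToDualLocal` (composite of the three equivalences). [folklore] -/
theorem layerToDualLocal_apply (hBbij : Bijective fun a : MA ↦ B.flip a) {sD : absoluteGaloisGroup (v₀.adicCompletion K) ⧸ localSubgroupOfEmb U (closureEmb (K := K) (v₀.adicCompletion K)) → absoluteGaloisGroup (v₀.adicCompletion K)}
    (hsD : ∀ y, (sD y : absoluteGaloisGroup (v₀.adicCompletion K) ⧸ localSubgroupOfEmb U (closureEmb (K := K) (v₀.adicCompletion K))) = y)
    (hsD1 : sD ((1 : absoluteGaloisGroup (v₀.adicCompletion K)) : _ ⧸ localSubgroupOfEmb U (closureEmb (K := K) (v₀.adicCompletion K))) = 1) (hsurj : Surjective (quotientMapOfHom U (resGalOfEmb (closureEmb (K := K) (v₀.adicCompletion K)))))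
    (x : continuousCohomology 1 (subgroupRep (TopRep.res (resGalOfEmb (closureEmb (K := K) (v₀.adicCompletion K)) : absoluteGaloisGroup (v₀.adicCompletion K) →* absoluteGaloisGroup K) ρA.toTopRep) (U.comap (resGalOfEmb (closureEmb (K := K) (v₀.adicCompletion K)) : absoluteGaloisGroup (v₀.adicCompletion K) →* absoluteGaloisGroup K)))) :
    layerToDualLocal K n ρX ρA B hB U hU v₀ hBbij hsD hsD1 hsurj x =
      dualEquivLocal K n ρX ρA B hB U hU v₀ hBbij ((mackeyEquivLocal K ρA U v₀ hsurj).symm (shapiroEquivLocal K ρA U hU v₀ hsD hsD1 x)) :=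
  rfl

/-! ## §2. `e` on localisations of global classes -/

omit [NeZero n] [Finite MA] in
/-- ★ **`e(θ_U^* c) = loc_{v₀}(H¹(Ψ)(Sh_U c))`** for a global class `c ∈ H¹(U, A)`: the one-orbit identity `H¹(θ, Φ₁)(Sh_U c) = Sh_{U_{v₀}}(θ_U^* c)` (tree
`map_resCoindFinHom_shapiroLift`) and naturality of restriction in the coefficients. [cite: Brown1982, III §5 (5.6)(b)] [cite: NeukirchSchmidtWingberg2008, I §6 Prop. (1.6.4)] -/
theorem layerToDualLocal_map_comapSubtypeHom (hBbij : Bijective fun a : MA ↦ B.flip a) {sD : absoluteGaloisGroup (v₀.adicCompletion K) ⧸ localSubgroupOfEmb U (closureEmb (K := K) (v₀.adicCompletion K)) → absoluteGaloisGroup (v₀.adicCompletion K)}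
    (hsD : ∀ y, (sD y : absoluteGaloisGroup (v₀.adicCompletion K) ⧸ localSubgroupOfEmb U (closureEmb (K := K) (v₀.adicCompletion K))) = y)
    (hsD1 : sD ((1 : absoluteGaloisGroup (v₀.adicCompletion K)) : _ ⧸ localSubgroupOfEmb U (closureEmb (K := K) (v₀.adicCompletion K))) = 1) (hsurj : Surjective (quotientMapOfHom U (resGalOfEmb (closureEmb (K := K) (v₀.adicCompletion K)))))
    {s : absoluteGaloisGroup K ⧸ U → absoluteGaloisGroup K} (hs : ∀ y, (s y : absoluteGaloisGroup K ⧸ U) = y)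
    (hs1 : s ((1 : absoluteGaloisGroup K) : absoluteGaloisGroup K ⧸ U) = 1) (c : continuousCohomology 1 (subgroupRep ρA.toTopRep U)) :
    layerToDualLocal K n ρX ρA B hB U hU v₀ hBbij hsD hsD1 hsurj
        (ContinuousCohomology.map (comapSubtypeHom U (resGalOfEmb (closureEmb (K := K) (v₀.adicCompletion K))))
          (comapCoeffHom ρA.toTopRep U (resGalOfEmb (closureEmb (K := K) (v₀.adicCompletion K)))) 1 c) =
      galoisCohomology.localization ((ρX.coind U hU).tateDual n) (Sum.inr v₀) 1
        (cohomologyMap (coindTateDualMor ρX ρA U B hU hB) 1 (shapiroLift ρA.toTopRep U hU hs hs1 c)) := by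
  -- (1) one orbit: `(H¹(Φ₁))⁻¹ (Sh_{U_v}(θ* c)) = θ^*(Sh_U c)`
  have h1 : (mackeyEquivLocal K ρA U v₀ hsurj).symm
      (shapiroEquivLocal K ρA U hU v₀ hsD hsD1
        (ContinuousCohomology.map (comapSubtypeHom U (resGalOfEmb (closureEmb (K := K) (v₀.adicCompletion K))))
          (comapCoeffHom ρA.toTopRep U (resGalOfEmb (closureEmb (K := K) (v₀.adicCompletion K)))) 1 c)) =
      ContinuousCohomology.map (resGalOfEmb (closureEmb (K := K) (v₀.adicCompletion K)))
        (𝟙 (TopRep.res (resGalOfEmb (closureEmb (K := K) (v₀.adicCompletion K)) : absoluteGaloisGroup (v₀.adicCompletion K) →* absoluteGaloisGroup K) (coindFin.{0, 0} ρA.toTopRep U))) 1 (shapiroLift ρA.toTopRep U hU hs hs1 c) := by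
    refine (AddEquiv.symm_apply_eq _).mpr ?_
    rw [mackeyEquivLocal_apply, shapiroEquivLocal_apply]
    have h0 := map_resCoindFinHom_shapiroLift ρA.toTopRep U (resGalOfEmb (closureEmb (K := K) (v₀.adicCompletion K))) hU hs hs1 hsD hsD1 c
    rw [← cohomologyMap_map_id_eq_map] at h0
    exact h0.symm
  rw [layerToDualLocal_apply, h1, dualEquivLocal_apply, cohomologyMap_map_id_eq_map]
  have h2 := map_cohomologyMap_eq_map (resGalOfEmb (closureEmb (K := K) (v₀.adicCompletion K))) (coindTateDualMor ρX ρA U B hU hB)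
    (𝟙 _) 1 (shapiroLift ρA.toTopRep U hU hs hs1 c)
  rw [Category.comp_id] at h2
  exact h2.symm

/-! ## §3. The canonical base-field local Tate pairing against `e ℓ` IS the layer pairing -/

omit [NeZero n] [Finite MX] [Finite MA] hUn hfq in
/-- Unfolding the tree's `localTatePairing` (a bundled `AddMonoidHom`) to the cup product of `tateDualPairingLocal`. [cite: MilneADT2006, Ch. I, Cor. 2.3] -/
theorem localTatePairing_eq_cupProduct {M : Type} [AddCommGroup M] [TopologicalSpace M] [DiscreteTopology M] [Finite M]
    (ρ : DiscreteGaloisModule K M) (w : Place K) (x : galoisCohomology (ρ.toLocal w) 1) (x' : galoisCohomology ((ρ.tateDual n).toLocal w) 1) :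
    localTatePairing ρ n w x x' = (tateDualPairingLocal ρ n w).cupProduct x x' := rfl

omit [Finite MA] in
/-- ★★ **`⟨loc_{v₀}(Sh_U y), e ℓ⟩_{v₀}^{can} = ⟨θ_U^* y, ℓ⟩_{U_{v₀}}`**: the tree's base-field local Tate pairing `localTatePairingZMod` of the coinduced module `Maps(Γ_K ⧸ U, X)`
for THE canonical invariant map at `v₀`, between the localisation of a global Shapiro lift `Sh_U y` (`y ∈ H¹(U, X)`) and the dictionary image `e ℓ` of a layer class
`ℓ ∈ H¹(U_{v₀}, A)`, equals J3's cor-model layer pairing `localPairingSubgroup … U_{v₀} (θ_U^* y) ℓ` for the pairing `B` (adjointness of evaluation and summed pairing across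
`Ψ`, Mackey's one-orbit cup formula with an arbitrary second factor, and the bridge R1 `cor(a ∪ b) = Sh a ∪_Σ Sh b`).
[cite: NeukirchSchmidtWingberg2008, I §5 Prop. (1.5.3)(iv), I §6 Prop. (1.6.4), (7.2.6)] [cite: MilneADT2006, Ch. I, Cor. 2.3 and §6 (proof of Prop. 6.9)] [cite: Brown1982, III §5 (5.6)(b)] -/
theorem localTatePairingZMod_canonical_layerToDualLocal
    [hcl : IsClosed (localSubgroupOfEmb U (closureEmb (K := K) (v₀.adicCompletion K)) : Set (absoluteGaloisGroup (v₀.adicCompletion K)))]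
    (hBbij : Bijective fun a : MA ↦ B.flip a) {sD : absoluteGaloisGroup (v₀.adicCompletion K) ⧸ localSubgroupOfEmb U (closureEmb (K := K) (v₀.adicCompletion K)) → absoluteGaloisGroup (v₀.adicCompletion K)}
    (hsD : ∀ y, (sD y : absoluteGaloisGroup (v₀.adicCompletion K) ⧸ localSubgroupOfEmb U (closureEmb (K := K) (v₀.adicCompletion K))) = y)
    (hsD1 : sD ((1 : absoluteGaloisGroup (v₀.adicCompletion K)) : _ ⧸ localSubgroupOfEmb U (closureEmb (K := K) (v₀.adicCompletion K))) = 1) (hsurj : Surjective (quotientMapOfHom U (resGalOfEmb (closureEmb (K := K) (v₀.adicCompletion K)))))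
    {s : absoluteGaloisGroup K ⧸ U → absoluteGaloisGroup K} (hs : ∀ y, (s y : absoluteGaloisGroup K ⧸ U) = y)
    (hs1 : s ((1 : absoluteGaloisGroup K) : absoluteGaloisGroup K ⧸ U) = 1) (y : continuousCohomology 1 (subgroupRep ρX.toTopRep U))
    (ℓ : continuousCohomology 1 (subgroupRep (TopRep.res (resGalOfEmb (closureEmb (K := K) (v₀.adicCompletion K)) : absoluteGaloisGroup (v₀.adicCompletion K) →* absoluteGaloisGroup K) ρA.toTopRep) (U.comap (resGalOfEmb (closureEmb (K := K) (v₀.adicCompletion K)) : absoluteGaloisGroup (v₀.adicCompletion K) →* absoluteGaloisGroup K)))) :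
    localTatePairingZMod (ρX.coind U hU) n (Sum.inr v₀) (LocalInvariants.canonical K n (Sum.inr v₀))
        (galoisCohomology.localization (ρX.coind U hU) (Sum.inr v₀) 1 (shapiroLift ρX.toTopRep U hU hs hs1 y))
        (layerToDualLocal K n ρX ρA B hB U hU v₀ hBbij hsD hsD1 hsurj ℓ) =
      localPairingSubgroup K n v₀ (ρX.restrict (resGalOfEmb (closureEmb (K := K) (v₀.adicCompletion K))))
        (ρA.restrict (resGalOfEmb (closureEmb (K := K) (v₀.adicCompletion K)))) (resPairingAt K n ρX ρA (pairing ρX ρA (mu K n) B hB) v₀)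
        (localSubgroupOfEmb U (closureEmb (K := K) (v₀.adicCompletion K)))
        (ContinuousCohomology.map (comapSubtypeHom U (resGalOfEmb (closureEmb (K := K) (v₀.adicCompletion K))))
          (comapCoeffHom ρX.toTopRep U (resGalOfEmb (closureEmb (K := K) (v₀.adicCompletion K)))) 1 y) ℓ := by
  letI hfq' : Fintype (absoluteGaloisGroup (v₀.adicCompletion K) ⧸ U.comap (resGalOfEmb (closureEmb (K := K) (v₀.adicCompletion K)) : absoluteGaloisGroup (v₀.adicCompletion K) →* absoluteGaloisGroup K)) := hfq
  -- the class `z ∈ H¹(K_{v₀}, Maps(Γ_K ⧸ U, A)|)` with `H¹(Φ₁) z = Sh_{U_v} ℓ`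
  set z := (mackeyEquivLocal K ρA U v₀ hsurj).symm (shapiroEquivLocal K ρA U hU v₀ hsD hsD1 ℓ) with hz
  have hz' : cohomologyMap (resCoindFinHom ρA.toTopRep U (resGalOfEmb (closureEmb (K := K) (v₀.adicCompletion K)))) 1 z =
      shapiroLift (TopRep.res (resGalOfEmb (closureEmb (K := K) (v₀.adicCompletion K)) : absoluteGaloisGroup (v₀.adicCompletion K) →* absoluteGaloisGroup K) ρA.toTopRep) (U.comap (resGalOfEmb (closureEmb (K := K) (v₀.adicCompletion K)) : absoluteGaloisGroup (v₀.adicCompletion K) →* absoluteGaloisGroup K))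
        (isOpen_comap U (resGalOfEmb (closureEmb (K := K) (v₀.adicCompletion K))) hU) hsD hsD1 ℓ := by
    rw [← mackeyEquivLocal_apply K ρA U v₀ hsurj, hz, AddEquiv.apply_symm_apply, shapiroEquivLocal_apply]
  -- (1) unfold the base-field pairing to the cup product of the evaluation pairing
  rw [localTatePairingZMod_apply, LocalInvariants.canonical_inr, layerToDualLocal_apply, dualEquivLocal_apply, localTatePairing_eq_cupProduct]
  -- (2) move `Ψ` across by adjointness: `⟨x, Ψ z⟩_{ev} = ⟨x, z⟩_{ΣB}` (all local types on the `X`-side read in the `toLocal` dialect)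
  have hadj := ContPairing.cupProduct_adjoint (X₂ := ((ρX.coind U hU).toLocal (Sum.inr v₀ : Place K)).toTopRep)
    (tateDualPairingLocal (ρX.coind U hU) n (Sum.inr v₀))
    (((pairing ρX ρA (mu K n) B hB).coindFin U).restrict (resGalOfEmb (closureEmb (K := K) (v₀.adicCompletion K))))
    (𝟙 _) ((TopRep.resFunctor (resGalOfEmb (closureEmb (K := K) (v₀.adicCompletion K)) : absoluteGaloisGroup (v₀.adicCompletion K) →* absoluteGaloisGroup K)).map (coindTateDualMor ρX ρA U B hU hB))
    (fun F G ↦ (tateDualPairing_toLin_coindTateDualMor ρX ρA U B hU hB F G).symm)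
    (galoisCohomology.localization (ρX.coind U hU) (Sum.inr v₀) 1 (shapiroLift ρX.toTopRep U hU hs hs1 y)) z
  rw [cohomologyMap_id_apply] at hadj
  -- (3) Mackey's one-orbit cup formula with the arbitrary second factor `z`, in the `TopRep.res θ` dialect
  have hbij : Bijective fun q : Unit × (absoluteGaloisGroup (v₀.adicCompletion K) ⧸ U.comap (resGalOfEmb (closureEmb (K := K) (v₀.adicCompletion K)) : absoluteGaloisGroup (v₀.adicCompletion K) →* absoluteGaloisGroup K)) ↦
      quotientMapOfHom U (resGalOfEmb (closureEmb (K := K) (v₀.adicCompletion K))) q.2 *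
        (((fun _ : Unit ↦ (1 : absoluteGaloisGroup K)) q.1 : absoluteGaloisGroup K) : absoluteGaloisGroup K ⧸ U) := by
    have hinj := quotientMapOfHom_injective U (resGalOfEmb (closureEmb (K := K) (v₀.adicCompletion K)))
    constructor
    · rintro ⟨u₁, y₁⟩ ⟨u₂, y₂⟩ h
      simp only [QuotientGroup.mk_one, mul_one] at h
      exact Prod.ext (Subsingleton.elim _ _) (hinj h)
    · intro y'
      obtain ⟨y'', hy''⟩ := hsurj y'
      exact ⟨((), y''), by simp only [QuotientGroup.mk_one, mul_one]; exact hy''⟩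
  have hM := cupProduct_map_shapiroLift_eq_sum_orbits (pairing ρX ρA (mu K n) B hB) U (resGalOfEmb (closureEmb (K := K) (v₀.adicCompletion K))) hU
    (fun _ : Unit ↦ (1 : absoluteGaloisGroup K)) hbij hs hs1 hsD hsD1 y z
  have hΦ : resCoindFinHomR ρA.toTopRep U (resGalOfEmb (closureEmb (K := K) (v₀.adicCompletion K))) (1 : absoluteGaloisGroup K ⧸ U) =
      resCoindFinHom ρA.toTopRep U (resGalOfEmb (closureEmb (K := K) (v₀.adicCompletion K))) :=
    TopRep.hom_ext (ContIntertwiningMap.ext (ContinuousLinearMap.ext fun F ↦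
      resCoindFinHomR_one ρA.toTopRep U (resGalOfEmb (closureEmb (K := K) (v₀.adicCompletion K))) F))
  rw [Fintype.sum_unique] at hM
  simp only [QuotientGroup.mk_one] at hM
  rw [hΦ, hz', conjMap_one_one] at hM
  have hfin : localInvariantMap K n v₀ ((((pairing ρX ρA (mu K n) B hB).coindFin U).restrict (resGalOfEmb (closureEmb (K := K) (v₀.adicCompletion K)))).cupProduct
      (ContinuousCohomology.map (resGalOfEmb (closureEmb (K := K) (v₀.adicCompletion K)))
        (𝟙 (TopRep.res (resGalOfEmb (closureEmb (K := K) (v₀.adicCompletion K)) : absoluteGaloisGroup (v₀.adicCompletion K) →* absoluteGaloisGroup K) (coindFin ρX.toTopRep U))) 1 (shapiroLift ρX.toTopRep U hU hs hs1 y)) z) =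
      localPairingSubgroup K n v₀ (ρX.restrict (resGalOfEmb (closureEmb (K := K) (v₀.adicCompletion K))))
        (ρA.restrict (resGalOfEmb (closureEmb (K := K) (v₀.adicCompletion K)))) (resPairingAt K n ρX ρA (pairing ρX ρA (mu K n) B hB) v₀)
        (localSubgroupOfEmb U (closureEmb (K := K) (v₀.adicCompletion K)))
        (ContinuousCohomology.map (comapSubtypeHom U (resGalOfEmb (closureEmb (K := K) (v₀.adicCompletion K))))
          (comapCoeffHom ρX.toTopRep U (resGalOfEmb (closureEmb (K := K) (v₀.adicCompletion K)))) 1 y) ℓ := by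
    rw [hM]
    exact (localPairingSubgroup_eq_localInvariantMap_cupProduct_shapiroLift K n v₀
      (ρX.restrict (resGalOfEmb (closureEmb (K := K) (v₀.adicCompletion K)))) (ρA.restrict (resGalOfEmb (closureEmb (K := K) (v₀.adicCompletion K))))
      (resPairingAt K n ρX ρA (pairing ρX ρA (mu K n) B hB) v₀) (localSubgroupOfEmb U (closureEmb (K := K) (v₀.adicCompletion K)))
      (isOpen_comap U (resGalOfEmb (closureEmb (K := K) (v₀.adicCompletion K))) hU) hsD hsD1 _ _).symm
  -- (4) assemble (the remaining identifications `loc_{v₀} = θ^*`, `toLocal = TopRep.res θ` are definitional)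
  exact ((congrArg (localInvariantMap K n v₀) hadj).symm).trans hfin

end Dict

end Summit.BirchSwinnertonDyer.BirchSwinnertonDyer.Theorems.SmallImageRttD2Seq

end
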